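import Summits.AtomisticToContinuum.FouriersLaw.Theorems.BondHeatUncertaintyBoundedResponseBathHeatOwedHeatC
import HarnessLib

/-!
# BondHeatUncertainty / BoundedResponse — «OwedHeat»: the TAIL-CUMULATIVE (horizon) axis — owed heat, late overshoot, and the bath tail
# functional NON-DECREASING IN ITS HORIZON past the light cone
(decomp-a2c lens-1 «grading / quantitative ladder», g115, NODE 115 «OwedHeat»; blocker item stmt-AtomisticToContinuum-11071 = `BoundedResponse`;
residual of record beneath (S) `SubdiffusiveBondHeat` = `LateTailFloor a 1 1`; main file (part 4 of 4) of the chain `…BathHeatOwedHeatA` (§1–§2: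
objects + generic layer cakes) → `…BathHeatOwedHeatB` (§3–§4: kernel- and kick-level identities, the two mechanisms) → `…BathHeatOwedHeatC` (§5 the
route statements) → this file (§6 the doors + this overview); imports only the TREE: NODE 114 `…BathHeatSeparation` (hence NODES 109–111 and the
generic layer cake `intervalIntegral_integral_Ioi_eq_integral_min_mul` of `…SubdiffusiveBondHeatTransientSpectral`), g97 `…TailSign`, the
Literature support file `Literature.Analysis.FunctionSpaces.L2ValuedPathDeriv` (Cauchy–Schwarz on an interval, cited not restated), + `HarnessLib`.)

THE AXIS GRADED HERE IS THE KERNEL'S TAIL = THE FUNCTIONAL'S HORIZON — not the kick level (NODE 114), not the lag window or horizon scaling of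
the kick curve (112/113), not the pointwise lag (109/110), not parity (in tree). Three objects (file A):
  `𝒯_N(v)   := ∫_{(v,∞)} K_N(r) dr`                 OWED HEAT — `(γ/T²)𝒯_N(v) = θ_N(∞) − θ_N(v)`, the rise STILL TO COME of the contact step response
                                                     (`owedHeat_eq_stepResponse_gap`); `γ²𝒯_N` is the horizon derivative of `B_N` (`bathTail_sub_eq`);
  `𝔗^v_N(k) := ∫_{(v,∞)} (Ḡ_{N,u}(k) − T) du`        KICK-RESOLVED OWED HEAT (after a boundary kick of momentum `k`; NODE 110's curve, FUTURE-integrated);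
  `𝒪_N(s,t) := ∫ₛᵗ 𝒯_N(v)⁻ dv`                      LATE OVERSHOOT (how much the step response sits ABOVE its final value, integrated over `[s,t]`).
IDENTITIES (all proved, files A/B): `B_N(t) = γ²∫₀ᵗ 𝒯_N` (the bath tail functional IS ACCUMULATED OWED HEAT); ★★ THE LATE LAYER CAKE
`B^late_N(s,t) = γ²(∫_{2s}^{t} 𝒯_N + 2∫_{s}^{2s} 𝒯_N)` (`bathTailLate_eq_owedHeat`: NODE 109's late tail charges ONLY owed heat at late horizons
`v ≥ s`, with weight `≤ 2`; real-variable core `integral_lateWeight_mul_eq`), hence `B^late ≥ −2γ²𝒪_N(s,t)` and `𝒪_N ≤ 𝔐_N` (NODE 109's late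
negative mass: `lateOvershoot_le_lateNegMass`) and, SIGN-FREE, `𝒪_N(s,t)² ≤ (t − s)∫ₛᵗ𝒯_N²` (`lateOvershoot_sq_le`); KICK BY KICK `𝔊^{s,t}_N(k) = ∫_{2s}^{t}𝔗^v_N(k)dv + 2∫_{s}^{2s}𝔗^v_N(k)dv` and
`𝔊^{0,t₂}_N(k) − 𝔊^{0,t₁}_N(k) = ∫_{t₁}^{t₂} 𝔗^v_N(k) dv` (NODE 111's heat-return curve IS late kick-resolved owed heat); `0 ≤ 𝒯_N(v) ⟺ θ_N(v) ≤ 1 − E_N`.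

§5 ROUTE STATEMENTS (each `UNDECIDED · phonon-TRUE · INSTRUMENTABLE`, eventually in `N`, late lags `≥ aN` only; NOT literature facts; none is 11071
or (S) reworded — MustFail115; the fixed-`N`/all-lag forms are numerically FALSE at `N = 1` (g97: `∫_{2.5}^∞K_1 < 0`) and are NOT filed):
  (OH_a)    `LateOwedHeatSign a`       `∀ v ≥ aN: 𝒯_N(v) ≥ 0` — «past the light cone the chain ALWAYS STILL OWES the contact heat»: the contact step
            response never overshoots its final value late ⟺ ★★ `B_N` NON-DECREASING IN ITS HORIZON on `[aN,∞)` (`lateOwedHeatSign_iff_bathTail_monotoneOn`)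
            ⟺ every late negative lobe of `K_N` is REPAID by later positive mass. IDEA-NEEDED: an emergent maximum principle for the coarse-grained dynamics.
  (OB_{a,g}) `LateOvershootBudget a g`  `γ²𝒪_N(aN,cN²) ≤ C·N^g` — ★★ THE NEW WEAKEST ONE-SIDED SUPPLIER of the residual (`g = 1`): it charges only NET
            (unrepaid) overshoot where NODE 109's `LateNegMass` charges every negative lobe weighted by its lag.
  (T2_{a,e}) `LateOwedHeatSquareBudget a e` `γ⁴∫_{aN}^{cN²}𝒯_N² ≤ C·N^e` — the SIGN-FREE supplier: the step response is `L²`-close to its limit past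
            the light cone; immune to echoes of either sign; heuristic size `γ²T⁴ log N/N` (room `N/log N` at `e = 0`); `e < 0` ⟹ overshoot grade `< 1`.
  (OHK_a)   `LateOwedHeatKickSigned a` `∀ v ≥ aN ∀ k: (k²−T)·𝔗^v_N(k) ≥ 0` — kick-resolved: after a HOT kick the chain still owes heat at every late lag.
  (HRS_a)   `LateHeatReturnSigned a`   `∀ k: (k²−T)·𝔊^{aN,cN²}_N(k) ≥ 0` — THE LAG-AVERAGED SIGN DOOR asked for by the critic (row 1559, (E5)(α)).

§6 DOORS (every arrow PROVED; `a ≥ 0`, `g ≤ 1`; `owedHeat_ladder`):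
      (KS_a) ══⟹ (OHK_a) ══⟹ (OH_a) ══⟹ (OB_{a,g}) ══⟹ `LateTailFloor a 1 g` ══[(S), g ≤ 1]══⟹ 11071
        ║          ║          [⟺ B_N monotone]      ⇑ `LateNegMass a` (NODE 109) at g = 1   ⇑ (T2_{a,e}) at g = 1 + e/2 (Cauchy–Schwarz, no sign)
        ║          ╚══⟹ (HRS_a) ══⟹ `LateTailFloor a 1 g` ∧ `LateHeatReturnFloor a g` with constant 0 (above NODE 111/114's whole defect family)
        ╚══⟹ (OH_a) directly (`K_N ≥ 0` late, NODE 114)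
  (KS)⟹(OHK): integrate the instantaneous sign over `u > v`. (OHK)⟹(OH): thermal pairing of the horizon increments makes `B_N` non-decreasing on
  `[aN,∞)` (`bathTail_le_of_kickSigned`), and a continuous horizon derivative of a monotone function is `≥ 0` (`owedHeat_nonneg_of_monotoneOn`).
  (OHK)⟹(HRS): the kick-level late layer cake. (OH)⟹(OB): `C = 0`. (OB)⟹LTF: `B^late ≥ −2γ²𝒪`. LNM⟹(OB₁): `𝒪 ≤ 𝔐`. (T2)⟹(OB): `𝒪² ≤ cN²∫𝒯²`.
WHICH OF THE CRITIC'S OPTIONS THIS IS: (α)⁺ — the lag-averaged sign door (HRS) is CONTAINED as a rung with its own door and its non-reversals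
(MustFail115: HRS ↛ OHK ↛ KS is not provable by the battery; HRS and OH are incomparable; explicit surrogate witnesses in the memo), but the MAIN
content is not a sign statement: it is the budget (OB) strictly inside the gap `LateNegMass ⟹ LateTailFloor` that the lineage had left open since
NODE 109, and the structural reading (OH) ⟺ horizon-monotonicity of `B_N`. It is NOT (γ): no echo budget, no pinned-level inversion depth.
WHY EACH PIECE IS STRICTLY WEAKER THAN ITS PARENT AND NOT A COSTUME (real-variable witnesses, memo §2; formal non-provability MustFail115):
  LNM ↛ OB: a late negative lobe of depth `N` at lag `≍ aN` REPAID by the next lobe has `𝒪 = 0`, `𝔐 ≍ aN²`.  OB ↛ OH: any `O(N)` net overshoot.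
  LTF ↛ OB: `𝒯 = −N` on `[aN,2aN]`, `+2N` on `[2aN,3aN]` gives `B^late(aN,t) = 0` (`t ≥ 3aN`) but `𝒪 = aN²`.  OH ↛ KS / kernel sign: `K = −𝟙_{[v₀,v₀+1]}
  + 𝟙_{[v₀+1,v₀+2]}` has `𝒯 ≥ 0`.  OHK ↛ KS: the same per kick.  OH ↛ OHK, HRS ↛ OHK: a `ν_T`- (resp. `ℓ`-) average forgets kick-selective (resp.
  lag-selective) violations.  OB ↛ T2 (a positive `𝒯 ≍ 1` has `𝒪 = 0`, `∫𝒯² ≍ N²`), T2 ↛ OH (small overshoot allowed), LNM / LTF ↛ T2 (one-sided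
  vs. two-sided smallness).  OB_{a,g<1}, OH, OHK, HRS, T2 are INCOMPARABLE with 11071 (11071 ⟹ only `LateTailFloor a 1 1`, a two-sided `O(N)` statement
  that forces no sign and no decay); none implies (S); with (S) each closes 11071 only through the proved doors.
WHY NOVEL (lineage-relative): NODES 109–114 grade `K_N` or `Ḡ` POINTWISE in the lag, or `𝔊` by window / horizon SCALING, or by kick LEVEL; none
integrates over the FUTURE of a lag. New here: the objects `𝒯, 𝔗, 𝒪`; the identification of `B^late` as a weight-`≤ 2` late layer cake of `𝒯`; the
rung (OB) between LNM and LTF and its sign-free `L²` supplier (T2); (OH) as a property of the scalar Green–Kubo curve `t ↦ B_N(t)` ALONE (instrumentable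
from BKER tables without kick resolution); the late/eventual repair of g97's dead fixed-`N` `ReturnTailSign`. WHY (OH)/(OB) MAY HOLD WHERE POINTWISE SIGNS ARE DELICATE: at
`v ≍ aN` the diffusive owed heat is `≍ (T²/γ)N^{-1/2}` while an echo lobe of `K_N` has area `≲ N^{-1}` — the tail sign is protected by a POWER of `N`;
the pointwise sign (`K_N(aN) ≍ N^{-3/2}` against an echo `≍ N^{-1}`) is not. THREAT (all four): an undamped quasi-ballistic echo train up to the Thouless
time `≍ N²/D` — the near-integrable regime where (S) fails too; at fixed `N` the very late sign is that of the slowest diffusive mode, so the danger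
zone is `aN ≤ v ≲ N²/D` only. BARRIERS: no file of `Literature/Barriers/AtomisticToContinuum/*` quantifies over tail-sign / horizon-monotonicity
statements of a boundary Green–Kubo functional (they concern momentum conservation / integrability / localisation, absent or dodged here: pinning
`ω₂ > 0`, Langevin ends, `N ≥ N₀`); nearest print context: negative stretches of heat-current autocorrelations in MD practice
[corpus:kaviany2014-heat-transfer-physics p.160, 240–243], Kubo running integrals [corpus:livi2017-nonequilibrium-statistical-physics-modern-perspective
p.172–175], [galaxy:panama:228500850081808] (Lepri ed., LNP 921) — no theorem deciding (OH)/(OB) for FPUT-β + Langevin ends found (queries in memo §4).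
CENSUS — ★ DESK READOUT OWED-115 (zero kit, from the EXISTING BKER-110 saturation table `S_N(v) = θ_N(v)`, census g43 `BKER110.md` §I7, P4 =
(1,8,1,1,4), `N = 16/32/64/128`, `1 − E_N` from the ACF-160 column): the owed heat in response units `(γ/T²)𝒯_N(v) = (1 − E_N) − S_N(v)` reads
`v = N`: `+0.052±0.02 / +0.074±0.01 / +0.037±0.007 / +0.024±0.007` (2.6 / 7.4 / 5.3 / 3.4 σ) — POSITIVE AND RESOLVED AT EVERY `N` ((OH₁) at its
first lag); `v = N/2`: `+0.096 / +0.094 / +0.059 / +0.037` (9–13 σ); `v = 2N`: `+0.016 / +0.058 / +0.017 / +0.005` (0.8 / 5.8 / 1.7 / 0.5 σ);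
`v ≥ 4N`: `|·| ≤ 0.04`, inside `±0.02…0.1` — UNRESOLVED (no resolved overshoot anywhere, harmonic control HARM4 likewise `≥ 0` where resolved).
`N·(γ/T²)𝒯_N(v)` at `v = N/4, N/2, N`: `2.1/4.0/6.0/8.2`, `1.5/3.0/3.8/4.8`, `0.8/2.4/2.4/3.1` — GROWING roughly like `√N`, as the diffusive
heuristic `𝒯_N(aN) ≍ N^{-1/2}` predicts. Verdict: (OH_a), `a ≤ 1`, TRUE-LEANING where resolved; the danger zone `2N ≲ v ≲ N²/4` is below BKER-110's
noise floor. The instrument is KERNEL-LEVEL (no kick resolution, no `ℓ ≍ u` weight): variance per origin `∝` window, not `∝ c³N⁶` as for the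
KICK-111 / LEVEL-114 readings (census g45 (C)) — a `×16` longer kernel run resolves `S_N(4N)` to `±0.005`. Request OWED-115: that run, reporting
`N·((1−E_N) − S_N(v))` on `v ∈ [N/4, N²/4]` with batch errors, `γT²·N⁻¹∫_{aN}^{cN²}((1−E_N) − S_N)⁻ dv` (the (OB₁) number) and
`γ²T⁴∫_{aN}^{cN²}((1−E_N) − S_N)² dv` (the (T2₀) number) for `a ∈ {1,2,4}`, `c = 1/4`.
NOT CLAIMED: no piece is proved or refuted for the chain; nothing here closes an item; no sorry, no new axioms.
-/

noncomputable section

open MeasureTheory ProbabilityTheory Filter Topology Set Function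
open scoped NNReal ENNReal
open Literature.MathematicalPhysics.KineticTheory.HeatConduction
open Literature.MathematicalPhysics.KineticTheory OscillatorChain
open Literature.Probability.Process
open Summit.AtomisticToContinuum.FouriersLaw.Theorems.SubdiffusiveBondHeat
open Summit.AtomisticToContinuum.FouriersLaw.Theorems.SubdiffusiveBondHeat.EscapeGrading
open Summit.AtomisticToContinuum.FouriersLaw.Theorems.BoundedResponse.TransientBand
open Summit.AtomisticToContinuum.FouriersLaw.Theorems.BoundedResponse.ParityFloor
  (kinObs kinAct continuous_kinObs stronglyMeasurable_kinAct abs_kinAct_le harrisBound_exists weight_facts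
    oneSub_stepResponse_sub_escapeDeficit_eq_returnTail)
open Summit.AtomisticToContinuum.FouriersLaw.Theorems.OddSectorIrreversibility (pinnedChain_stronglyMeasurable_act_uncurry)

namespace Summit.AtomisticToContinuum.FouriersLaw.Theorems.BoundedResponse.HeatSpreading

open Summit.AtomisticToContinuum.FouriersLaw.Theses.BondHeatUncertainty (BoundedResponse SubdiffusiveBondHeat)

section Chain

variable {ω₂ lam β γ : ℝ} {T : ℝ}

/-! ## §6 (NODE 115) Doors -/

/-- ★ **(KS_a) ⟹ (OHK_a)**: integrate the instantaneous sign over the lags `u > v ≥ aN`. [this cell] -/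
theorem lateOwedHeatKickSigned_of_signed {a : ℝ} (h : LateKinResponseSigned a) : LateOwedHeatKickSigned a := by
  intro ω₂ lam β γ hω hl hβ hγ T hT
  obtain ⟨N₀, hN₀⟩ := h ω₂ lam β γ hω hl hβ hγ T hT
  refine ⟨N₀, fun N hN v hv k => ?_⟩
  unfold owedHeatKick
  rw [← integral_const_mul]
  exact setIntegral_nonneg measurableSet_Ioi fun u hu => hN₀ N hN u (hv.trans (le_of_lt (show v < u from hu))) k

/-- ★ **(KS_a) ⟹ (OH_a)**: a sign-coherent response curve has `K_N(u) ≥ 0` (NODE 114), and `𝒯_N(v) = ∫_{(v,∞)} K_N`. [this cell] -/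
theorem lateOwedHeatSign_of_signed {a : ℝ} (h : LateKinResponseSigned a) : LateOwedHeatSign a := by
  intro ω₂ lam β γ hω hl hβ hγ T hT
  obtain ⟨N₀, hN₀⟩ := h ω₂ lam β γ hω hl hβ hγ T hT
  refine ⟨max N₀ 1, fun N hN v hv => ?_⟩
  have hNN₀ : N₀ ≤ N := le_trans (le_max_left _ _) hN
  obtain ⟨n, rfl⟩ : ∃ n, N = n + 1 := ⟨N - 1, by have := le_trans (le_max_right _ _) hN; omega⟩
  unfold owedHeat
  exact setIntegral_nonneg measurableSet_Ioi fun u hu =>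
    bathKinCorr_nonneg_of_sign hω hl hβ hγ hT n (hN₀ (n + 1) hNN₀ u (hv.trans (le_of_lt (show v < u from hu))))

/-- ★ **(KS_a) ⟹ (HRS_a)** (`a ≥ 0`; NODE 114's `sqSub_mul_heatReturnProfile_nonneg` once `2aN ≤ cN²`). [this cell] -/
theorem lateHeatReturnSigned_of_signed {a : ℝ} (ha : 0 ≤ a) (h : LateKinResponseSigned a) : LateHeatReturnSigned a := by
  intro ω₂ lam β γ hω hl hβ hγ T hT c hc
  obtain ⟨N₀, hN₀⟩ := h ω₂ lam β γ hω hl hβ hγ T hT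
  obtain ⟨N₁, hN₁⟩ := eventually_lateWindow (a := a) (q := 2) hc N₀
  refine ⟨N₁, fun N hN k => ?_⟩
  obtain ⟨hNN₀, hN1, hw⟩ := hN₁ N hN
  obtain ⟨n, rfl⟩ : ∃ n, N = n + 1 := ⟨N - 1, by omega⟩
  exact sqSub_mul_heatReturnProfile_nonneg hω hl hβ hγ hT n (by positivity) (by linarith) (fun u hu k => hN₀ (n + 1) hNN₀ u hu k) k

/-- ★★ **(OH_a) ⟺ `B_N` EVENTUALLY NON-DECREASING IN ITS HORIZON PAST THE LIGHT CONE** (`a ≥ 0`): the tail sign is a statement about the bath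
Green–Kubo functional alone. [this cell] -/
theorem lateOwedHeatSign_iff_bathTail_monotoneOn {a : ℝ} (ha : 0 ≤ a) :
    LateOwedHeatSign a ↔
      ∀ ω₂ lam β γ : ℝ, 0 < ω₂ → 0 < lam → 0 < β → 0 < γ → ∀ T : ℝ, 0 < T →
        ∃ N₀ : ℕ, ∀ N : ℕ, N₀ ≤ N → MonotoneOn (bathTail ω₂ lam β γ T N) (Ici (a * N)) := by
  constructor
  · intro h ω₂ lam β γ hω hl hβ hγ T hT
    obtain ⟨N₀, hN₀⟩ := h ω₂ lam β γ hω hl hβ hγ T hT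
    refine ⟨N₀, fun N hN t₁ ht₁ t₂ _ h12 => ?_⟩
    have h01 : 0 ≤ t₁ := le_trans (by positivity) ht₁
    have e := bathTail_sub_eq hω hl hβ hγ hT N h01 h12
    have hnn : 0 ≤ ∫ v in t₁..t₂, owedHeat ω₂ lam β γ T N v :=
      intervalIntegral.integral_nonneg h12 fun v hv => hN₀ N hN v (le_trans ht₁ hv.1)
    have hγ2 : 0 ≤ γ ^ 2 := by positivity
    nlinarith [mul_nonneg hγ2 hnn]
  · intro h ω₂ lam β γ hω hl hβ hγ T hT
    obtain ⟨N₀, hN₀⟩ := h ω₂ lam β γ hω hl hβ hγ T hT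
    refine ⟨N₀, fun N hN v hv => ?_⟩
    exact owedHeat_nonneg_of_monotoneOn hω hl hβ hγ hT N (by positivity) (hN₀ N hN) hv

/-- ★★ **(OHK_a) ⟹ (OH_a)** (`a ≥ 0`): kick-resolved sign ⟹ `B_N` non-decreasing past the light cone (thermal pairing of the horizon increments)
⟹ tail sign (horizon derivative). [this cell] -/
theorem lateOwedHeatSign_of_kickSigned {a : ℝ} (ha : 0 ≤ a) (h : LateOwedHeatKickSigned a) : LateOwedHeatSign a := by
  rw [lateOwedHeatSign_iff_bathTail_monotoneOn ha]
  intro ω₂ lam β γ hω hl hβ hγ T hT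
  obtain ⟨N₀, hN₀⟩ := h ω₂ lam β γ hω hl hβ hγ T hT
  refine ⟨max N₀ 1, fun N hN t₁ ht₁ t₂ _ h12 => ?_⟩
  have hNN₀ : N₀ ≤ N := le_trans (le_max_left _ _) hN
  obtain ⟨n, rfl⟩ : ∃ n, N = n + 1 := ⟨N - 1, by have := le_trans (le_max_right _ _) hN; omega⟩
  exact bathTail_le_of_kickSigned hω hl hβ hγ hT n (by positivity) (fun v hv k => hN₀ (n + 1) hNN₀ v hv k) ht₁ h12

/-- ★ **(OHK_a) ⟹ (HRS_a)** (`a ≥ 0`): the late layer cake `𝔊^{aN,cN²} = ∫_{2aN}^{cN²} 𝔗 + 2∫_{aN}^{2aN} 𝔗`, kick by kick. [this cell] -/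
theorem lateHeatReturnSigned_of_kickSigned {a : ℝ} (ha : 0 ≤ a) (h : LateOwedHeatKickSigned a) : LateHeatReturnSigned a := by
  intro ω₂ lam β γ hω hl hβ hγ T hT c hc
  obtain ⟨N₀, hN₀⟩ := h ω₂ lam β γ hω hl hβ hγ T hT
  obtain ⟨N₁, hN₁⟩ := eventually_lateWindow (a := a) (q := 2) hc N₀
  refine ⟨N₁, fun N hN k => ?_⟩
  obtain ⟨hNN₀, hN1, hw⟩ := hN₁ N hN
  obtain ⟨n, rfl⟩ : ∃ n, N = n + 1 := ⟨N - 1, by omega⟩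
  have hs : (0:ℝ) ≤ a * ((n + 1 : ℕ) : ℝ) := by positivity
  have hst : 2 * (a * ((n + 1 : ℕ) : ℝ)) ≤ c * ((n + 1 : ℕ) : ℝ) ^ 2 := by linarith
  rw [heatReturnProfile_eq_owedHeatKick hω hl hβ hγ hT n hs hst k]
  have hA : 0 ≤ (k ^ 2 - T) * ∫ v in (2 * (a * ((n + 1 : ℕ) : ℝ)))..(c * ((n + 1 : ℕ) : ℝ) ^ 2),
      owedHeatKick ω₂ lam β γ T (n + 1) v k := by
    rw [← intervalIntegral.integral_const_mul]
    exact intervalIntegral.integral_nonneg hst fun v hv => hN₀ (n + 1) hNN₀ v (by linarith [hv.1]) k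
  have hB : 0 ≤ (k ^ 2 - T) * ∫ v in (a * ((n + 1 : ℕ) : ℝ))..(2 * (a * ((n + 1 : ℕ) : ℝ))),
      owedHeatKick ω₂ lam β γ T (n + 1) v k := by
    rw [← intervalIntegral.integral_const_mul]
    exact intervalIntegral.integral_nonneg (by linarith) fun v hv => hN₀ (n + 1) hNN₀ v hv.1 k
  nlinarith

/-- ★ **(OH_a) ⟹ (OB_{a,g}) with `C = 0` at every grade** (any `a`): no late overshoot at all. [this cell] -/
theorem lateOvershootBudget_of_lateOwedHeatSign {a : ℝ} (h : LateOwedHeatSign a) (g : ℝ) : LateOvershootBudget a g := by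
  intro ω₂ lam β γ hω hl hβ hγ T hT c hc
  obtain ⟨N₀, hN₀⟩ := h ω₂ lam β γ hω hl hβ hγ T hT
  obtain ⟨N₁, hN₁⟩ := eventually_lateWindow (a := a) (q := 1) hc N₀
  refine ⟨0, N₁, fun N hN => ?_⟩
  obtain ⟨hNN₀, hN1, hw⟩ := hN₁ N hN
  have hle : a * (N : ℝ) ≤ c * (N : ℝ) ^ 2 := by linarith
  have hz : lateOvershoot ω₂ lam β γ T N (a * N) (c * (N : ℝ) ^ 2) = 0 := by
    unfold lateOvershoot
    rw [intervalIntegral.integral_congr (g := fun _ => (0:ℝ)) (fun v hv => by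
      rw [uIcc_of_le hle] at hv
      show max (-(owedHeat ω₂ lam β γ T N v)) 0 = 0
      exact max_eq_right (by linarith [hN₀ N hNN₀ v hv.1])), intervalIntegral.integral_zero]
  rw [hz, mul_zero, zero_mul]

/-- ★★ **`LateNegMass a ⟹ (OB_{a,1})`** (`a ≥ 0`): the overshoot is at most the negative mass (`lateOvershoot_le_lateNegMass`). [this cell] -/
theorem lateOvershootBudget_of_lateNegMass {a : ℝ} (ha : 0 ≤ a) (h : LateNegMass a) : LateOvershootBudget a 1 := by
  intro ω₂ lam β γ hω hl hβ hγ T hT c hc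
  obtain ⟨C, N₀, hC⟩ := h ω₂ lam β γ hω hl hβ hγ T hT c hc
  obtain ⟨N₁, hN₁⟩ := eventually_lateWindow (a := a) (q := 1) hc N₀
  refine ⟨C, N₁, fun N hN => ?_⟩
  obtain ⟨hNN₀, hN1, hw⟩ := hN₁ N hN
  have hle : a * (N : ℝ) ≤ c * (N : ℝ) ^ 2 := by linarith
  have h1 := lateOvershoot_le_lateNegMass hω hl hβ hγ hT N (by positivity : (0:ℝ) ≤ a * N) hle
  have hγ2 : 0 ≤ γ ^ 2 := by positivity
  rw [Real.rpow_one]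
  exact le_trans (mul_le_mul_of_nonneg_left h1 hγ2) (hC N hNN₀)

/-- Grade monotonicity of the budget (`N ≥ 1`). [formal bookkeeping] -/
theorem lateOvershootBudget_mono {a g g' : ℝ} (hgg' : g ≤ g') (h : LateOvershootBudget a g) : LateOvershootBudget a g' := by
  intro ω₂ lam β γ hω hl hβ hγ T hT c hc
  obtain ⟨C, N₀, hC⟩ := h ω₂ lam β γ hω hl hβ hγ T hT c hc
  refine ⟨max C 0, max N₀ 1, fun N hN => ?_⟩
  have hNN₀ : N₀ ≤ N := le_trans (le_max_left _ _) hN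
  have hN1 : (1:ℝ) ≤ N := by exact_mod_cast le_trans (le_max_right _ _) hN
  have h1 : (N : ℝ) ^ g ≤ (N : ℝ) ^ g' := Real.rpow_le_rpow_of_exponent_le hN1 hgg'
  have h2 : C * (N : ℝ) ^ g ≤ max C 0 * (N : ℝ) ^ g := mul_le_mul_of_nonneg_right (le_max_left _ _) (Real.rpow_nonneg (by positivity) _)
  exact (hC N hNN₀).trans (h2.trans (mul_le_mul_of_nonneg_left h1 (le_max_right _ _)))

/-- ★★ **`(T2_{a,e}) ⟹ (OB_{a,1+e/2})`** (`a ≥ 0`): the SIGN-FREE door — Cauchy–Schwarz on the window `[aN, cN²]`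
(`lateOvershoot_sq_le`): `(γ²𝒪_N)² ≤ γ⁴·cN²·∫𝒯_N² ≤ c·C·N^{2+e}`. [this cell] -/
theorem lateOvershootBudget_of_squareBudget {a e : ℝ} (ha : 0 ≤ a) (h : LateOwedHeatSquareBudget a e) :
    LateOvershootBudget a (1 + e / 2) := by
  intro ω₂ lam β γ hω hl hβ hγ T hT c hc
  obtain ⟨C, N₀, hC⟩ := h ω₂ lam β γ hω hl hβ hγ T hT c hc
  obtain ⟨N₁, hN₁⟩ := eventually_lateWindow (a := a) (q := 1) hc N₀
  refine ⟨Real.sqrt (c * max C 0), N₁, fun N hN => ?_⟩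
  obtain ⟨hNN₀, hN1, hw⟩ := hN₁ N hN
  have hN0 : (0:ℝ) < N := by exact_mod_cast hN1
  have haN : (0:ℝ) ≤ a * N := by positivity
  have hle : a * (N : ℝ) ≤ c * (N : ℝ) ^ 2 := by linarith
  set O := lateOvershoot ω₂ lam β γ T N (a * N) (c * (N : ℝ) ^ 2) with hO
  set J := ∫ v in (a * N)..(c * (N : ℝ) ^ 2), owedHeat ω₂ lam β γ T N v ^ 2 with hJ
  have hO0 : 0 ≤ O := intervalIntegral.integral_nonneg hle fun v _ => le_max_right _ _
  have hJ0 : 0 ≤ J := intervalIntegral.integral_nonneg hle fun v _ => sq_nonneg _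
  have h1 : O ^ 2 ≤ (c * (N : ℝ) ^ 2 - a * N) * J := lateOvershoot_sq_le hω hl hβ hγ hT N haN hle
  have h2 : O ^ 2 ≤ c * (N : ℝ) ^ 2 * J := h1.trans (mul_le_mul_of_nonneg_right (by linarith) hJ0)
  have h3 : γ ^ 4 * J ≤ max C 0 * (N : ℝ) ^ e :=
    (hC N hNN₀).trans (mul_le_mul_of_nonneg_right (le_max_left _ _) (Real.rpow_nonneg hN0.le _))
  have hpow : ((N : ℝ) ^ (1 + e / 2)) ^ 2 = (N : ℝ) ^ 2 * (N : ℝ) ^ e := by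
    rw [← Real.rpow_two, ← Real.rpow_mul hN0.le, (by ring : (1 + e / 2) * 2 = 2 + e), Real.rpow_add hN0, Real.rpow_two]
  have hcC : 0 ≤ c * max C 0 := mul_nonneg hc.le (le_max_right _ _)
  have h4 : (γ ^ 2 * O) ^ 2 ≤ (Real.sqrt (c * max C 0) * (N : ℝ) ^ (1 + e / 2)) ^ 2 := by
    rw [mul_pow (Real.sqrt _), Real.sq_sqrt hcC, hpow]
    have h4a : γ ^ 4 * O ^ 2 ≤ γ ^ 4 * (c * (N : ℝ) ^ 2 * J) := mul_le_mul_of_nonneg_left h2 (by positivity)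
    have h4b : c * (N : ℝ) ^ 2 * (γ ^ 4 * J) ≤ c * (N : ℝ) ^ 2 * (max C 0 * (N : ℝ) ^ e) :=
      mul_le_mul_of_nonneg_left h3 (by positivity)
    nlinarith [h4a, h4b]
  have := sq_le_sq.1 h4
  rwa [abs_of_nonneg (mul_nonneg (by positivity) hO0),
    abs_of_nonneg (mul_nonneg (Real.sqrt_nonneg _) (Real.rpow_nonneg hN0.le _))] at this

/-- ★ **`(T2_{a,0}) ⟹ (OB_{a,1})`**: a uniformly bounded `γ⁴∫_{aN}^{cN²}𝒯_N²` already supplies the residual's grade. [this cell] -/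
theorem lateOvershootBudget_of_squareBudget_zero {a : ℝ} (ha : 0 ≤ a) (h : LateOwedHeatSquareBudget a 0) :
    LateOvershootBudget a 1 := by
  simpa using lateOvershootBudget_of_squareBudget ha h

/-- ★★ **`(OB_{a,g}) ⟹ LateTailFloor a 1 g`** (`a ≥ 0`; `B^late ≥ −2γ²𝒪` once `2aN ≤ cN²`). [this cell] -/
theorem lateTailFloor_of_lateOvershootBudget {a g : ℝ} (ha : 0 ≤ a) (h : LateOvershootBudget a g) : LateTailFloor a 1 g := by
  intro ω₂ lam β γ hω hl hβ hγ T hT c hc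
  obtain ⟨C, N₀, hC⟩ := h ω₂ lam β γ hω hl hβ hγ T hT c hc
  obtain ⟨N₁, hN₁⟩ := eventually_lateWindow (a := a) (q := 2) hc N₀
  refine ⟨2 * C, N₁, fun N hN => ?_⟩
  obtain ⟨hNN₀, hN1, hw⟩ := hN₁ N hN
  simp only [Real.rpow_one]
  have hb := bathTailLate_ge_neg_lateOvershoot hω hl hβ hγ hT (show 0 < N by omega) (by positivity : (0:ℝ) ≤ a * N)
    (by linarith : 2 * (a * (N : ℝ)) ≤ c * (N : ℝ) ^ 2)
  linarith [hC N hNN₀]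

/-- ★★ **(S) ∧ (OB_{a,g}) ⟹ 11071** (`a ≥ 0`, `g ≤ 1`). [this cell] -/
theorem boundedResponse_of_subdiffusiveBondHeat_lateOvershootBudget {a g : ℝ} (ha : 0 ≤ a) (hg : g ≤ 1) (hS : SubdiffusiveBondHeat)
    (h : LateOvershootBudget a g) : BoundedResponse :=
  boundedResponse_of_subdiffusiveBondHeat_lateTailFloor ha le_rfl hS (lateTailFloor_of_lateOvershootBudget ha (lateOvershootBudget_mono hg h))

/-- ★ **(HRS_a) ⟹ `LateTailFloor a 1 g` with constant `0` at every grade** (`B^late = γ²∫θ_T𝔊 dν_T`, NODE 111). [this cell] -/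
theorem lateTailFloor_of_lateHeatReturnSigned {a : ℝ} (ha : 0 ≤ a) (h : LateHeatReturnSigned a) (g : ℝ) : LateTailFloor a 1 g := by
  intro ω₂ lam β γ hω hl hβ hγ T hT c hc
  obtain ⟨N₀, hN₀⟩ := h ω₂ lam β γ hω hl hβ hγ T hT c hc
  refine ⟨0, max N₀ 1, fun N hN => ?_⟩
  have hNN₀ : N₀ ≤ N := le_trans (le_max_left _ _) hN
  obtain ⟨n, rfl⟩ : ∃ n, N = n + 1 := ⟨N - 1, by have := le_trans (le_max_right _ _) hN; omega⟩
  simp only [Real.rpow_one, zero_mul, neg_zero]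
  obtain ⟨-, e⟩ := bathTailLate_eq_integral_heatReturnProfile hω hl hβ hγ hT n (by positivity : (0:ℝ) ≤ a * ((n + 1 : ℕ) : ℝ))
    (by positivity : (0:ℝ) ≤ c * ((n + 1 : ℕ) : ℝ) ^ 2)
  rw [e]
  exact mul_nonneg (by positivity) (integral_nonneg fun k => hN₀ (n + 1) hNN₀ k)

/-- ★ **(HRS_a) ⟹ `LateHeatReturnFloor a g` with constant `0`** (`𝔇_T` of a sign-coherent curve vanishes): the lag-averaged sign sits above
NODE 111's whole defect family. [this cell] -/
theorem lateHeatReturnFloor_of_lateHeatReturnSigned {a : ℝ} (ha : 0 ≤ a) (h : LateHeatReturnSigned a) (g : ℝ) : LateHeatReturnFloor a g := by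
  intro ω₂ lam β γ hω hl hβ hγ T hT c hc
  obtain ⟨N₀, hN₀⟩ := h ω₂ lam β γ hω hl hβ hγ T hT c hc
  refine ⟨0, max N₀ 1, fun N hN => ?_⟩
  have hNN₀ : N₀ ≤ N := le_trans (le_max_left _ _) hN
  obtain ⟨n, rfl⟩ : ∃ n, N = n + 1 := ⟨N - 1, by have := le_trans (le_max_right _ _) hN; omega⟩
  rw [zero_mul]
  obtain ⟨hI, -⟩ := bathTailLate_eq_integral_heatReturnProfile hω hl hβ hγ hT n (by positivity : (0:ℝ) ≤ a * ((n + 1 : ℕ) : ℝ))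
    (by positivity : (0:ℝ) ≤ c * ((n + 1 : ℕ) : ℝ) ^ 2)
  exact le_of_eq (thermalCrossDefect_eq_zero_of_affineCross (a := 0) (b := 0) (fun k => by simpa using hN₀ (n + 1) hNN₀ k) hI)

/-- ★★★ **THE OWED-HEAT LADDER (NODE 115)**, `a ≥ 0`, `g ≤ 1`:
`(KS_a) ⟹ (OHK_a) ⟹ (OH_a) ⟹ (OB_{a,g}) ⟹ LateTailFloor a 1 g ⟹ [with (S)] 11071`, the kernel sign entering at (OH): `(KS_a) ⟹ (OH_a)`;
NODE 109's negative mass entering at the budget: `LateNegMass a ⟹ (OB_{a,1})`; and the lag-averaged sign branch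
`(OHK_a) ⟹ (HRS_a) ⟹ LateTailFloor a 1 g ∧ LateHeatReturnFloor a g` (constant `0`); the sign-free branch `(T2_{a,0}) ⟹ (OB_{a,1})`. [this cell] -/
theorem owedHeat_ladder {a g : ℝ} (ha : 0 ≤ a) (hg : g ≤ 1) :
    (LateKinResponseSigned a → LateOwedHeatKickSigned a) ∧
    (LateOwedHeatKickSigned a → LateOwedHeatSign a) ∧
    (LateKinResponseSigned a → LateOwedHeatSign a) ∧
    (LateOwedHeatSign a → LateOvershootBudget a g) ∧
    (LateNegMass a → LateOvershootBudget a 1) ∧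
    (LateOvershootBudget a g → LateTailFloor a 1 g) ∧
    (LateOwedHeatKickSigned a → LateHeatReturnSigned a) ∧
    (LateKinResponseSigned a → LateHeatReturnSigned a) ∧
    (LateHeatReturnSigned a → LateTailFloor a 1 g ∧ LateHeatReturnFloor a g) ∧
    (LateOwedHeatSquareBudget a 0 → LateOvershootBudget a 1) ∧
    (SubdiffusiveBondHeat → LateOvershootBudget a g → BoundedResponse) :=
  ⟨lateOwedHeatKickSigned_of_signed, lateOwedHeatSign_of_kickSigned ha, lateOwedHeatSign_of_signed,
    fun h => lateOvershootBudget_of_lateOwedHeatSign h g, lateOvershootBudget_of_lateNegMass ha,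
    lateTailFloor_of_lateOvershootBudget ha, lateHeatReturnSigned_of_kickSigned ha, lateHeatReturnSigned_of_signed ha,
    fun h => ⟨lateTailFloor_of_lateHeatReturnSigned ha h g, lateHeatReturnFloor_of_lateHeatReturnSigned ha h g⟩,
    lateOvershootBudget_of_squareBudget_zero ha,
    fun hS h => boundedResponse_of_subdiffusiveBondHeat_lateOvershootBudget ha hg hS h⟩

end Chain

end Summit.AtomisticToContinuum.FouriersLaw.Theorems.BoundedResponse.HeatSpreading

end
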